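import Summits.Ventures.PercRepro.C041TriangleLeafStar2A
import Summits.Ventures.PercRepro.C041TriangleLeafStar2B

/-!
# THEOREM (LEAF × TWO-LEAF STAR) — the triangle with one deformed leaf at one exit and a two-leaf star at the other lies
in the cone, for EVERY fugacities `a, b, c ∈ [0, 1]` (mine-3, gen 66; C-041.md §21 (bc))

The first kernel theorem of the row with two free INTERIOR stars: `θ_△(v c, v a * v b) ∈ cone`.  The certificate is the
exact Bernstein-quadratic identity `thetaTri_leaf_star2_eq`: `θ_△(v c, v a * v b) = leafStar2A a b c + leafStar2B a b c`
(the two halves of gen 61's kit-LP certificate, data/mine-3/g61/kit-j292929/leaf_star2.json: 77 generators, 417 terms,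
HiGHS support search + exact rational re-solve, re-verified exactly by tools/g66/gen_leafstar2.py before emission),
checked coordinate by coordinate by `ring` (`thetaTri_leaf_star2_coord0 … 5`); each half is a cone element
(`InCone_leafStar2A/B`: every coefficient is a non-negative combination of `a^i (1 − a)^{2−i} b^j (1 − b)^{2−j} c^k (1 − c)^{2−k}`,
every generator a product of at most two leaves at atoms in `[0, 1]`).  With `InCone_thetaTri_marks_V` (marked vertices)
this settles the triangle on every pair of stars with ≤ 1 + 2 leaves.
-/

namespace PercRepro

namespace RelaxedTriangle

open TreeClosure

/-- Coordinate 0 of the identity. -/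
theorem thetaTri_leaf_star2_coord0 (a b c : ℝ) :
    thetaTri (v c) (v a * v b) 0 = (leafStar2A a b c + leafStar2B a b c) 0 := by
  simp only [leafStar2A, leafStar2B, leafStar2A1, leafStar2A2, leafStar2A3, leafStar2A4, leafStar2A5, leafStar2A6, leafStar2A7, leafStar2B1, leafStar2B2, leafStar2B3, leafStar2B4, leafStar2B5, leafStar2B6, leafStar2B7, thetaTri_eq_vec, Pi.add_apply, Pi.smul_apply, Pi.mul_apply, Pi.one_apply, smul_eq_mul, v]
  simp
  ring

/-- Coordinate 1 of the identity. -/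
theorem thetaTri_leaf_star2_coord1 (a b c : ℝ) :
    thetaTri (v c) (v a * v b) 1 = (leafStar2A a b c + leafStar2B a b c) 1 := by
  simp only [leafStar2A, leafStar2B, leafStar2A1, leafStar2A2, leafStar2A3, leafStar2A4, leafStar2A5, leafStar2A6, leafStar2A7, leafStar2B1, leafStar2B2, leafStar2B3, leafStar2B4, leafStar2B5, leafStar2B6, leafStar2B7, thetaTri_eq_vec, Pi.add_apply, Pi.smul_apply, Pi.mul_apply, Pi.one_apply, smul_eq_mul, v]
  simp
  ring

/-- Coordinate 2 of the identity. -/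
theorem thetaTri_leaf_star2_coord2 (a b c : ℝ) :
    thetaTri (v c) (v a * v b) 2 = (leafStar2A a b c + leafStar2B a b c) 2 := by
  simp only [leafStar2A, leafStar2B, leafStar2A1, leafStar2A2, leafStar2A3, leafStar2A4, leafStar2A5, leafStar2A6, leafStar2A7, leafStar2B1, leafStar2B2, leafStar2B3, leafStar2B4, leafStar2B5, leafStar2B6, leafStar2B7, thetaTri_eq_vec, Pi.add_apply, Pi.smul_apply, Pi.mul_apply, Pi.one_apply, smul_eq_mul, v]
  simp
  ring

/-- Coordinate 3 of the identity. -/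
theorem thetaTri_leaf_star2_coord3 (a b c : ℝ) :
    thetaTri (v c) (v a * v b) 3 = (leafStar2A a b c + leafStar2B a b c) 3 := by
  simp only [leafStar2A, leafStar2B, leafStar2A1, leafStar2A2, leafStar2A3, leafStar2A4, leafStar2A5, leafStar2A6, leafStar2A7, leafStar2B1, leafStar2B2, leafStar2B3, leafStar2B4, leafStar2B5, leafStar2B6, leafStar2B7, thetaTri_eq_vec, Pi.add_apply, Pi.smul_apply, Pi.mul_apply, Pi.one_apply, smul_eq_mul, v]
  simp
  ring

/-- Coordinate 4 of the identity. -/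
theorem thetaTri_leaf_star2_coord4 (a b c : ℝ) :
    thetaTri (v c) (v a * v b) 4 = (leafStar2A a b c + leafStar2B a b c) 4 := by
  simp only [leafStar2A, leafStar2B, leafStar2A1, leafStar2A2, leafStar2A3, leafStar2A4, leafStar2A5, leafStar2A6, leafStar2A7, leafStar2B1, leafStar2B2, leafStar2B3, leafStar2B4, leafStar2B5, leafStar2B6, leafStar2B7, thetaTri_eq_vec, Pi.add_apply, Pi.smul_apply, Pi.mul_apply, Pi.one_apply, smul_eq_mul, v]
  simp
  ring

/-- Coordinate 5 of the identity. -/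
theorem thetaTri_leaf_star2_coord5 (a b c : ℝ) :
    thetaTri (v c) (v a * v b) 5 = (leafStar2A a b c + leafStar2B a b c) 5 := by
  simp only [leafStar2A, leafStar2B, leafStar2A1, leafStar2A2, leafStar2A3, leafStar2A4, leafStar2A5, leafStar2A6, leafStar2A7, leafStar2B1, leafStar2B2, leafStar2B3, leafStar2B4, leafStar2B5, leafStar2B6, leafStar2B7, thetaTri_eq_vec, Pi.add_apply, Pi.smul_apply, Pi.mul_apply, Pi.one_apply, smul_eq_mul, v]
  simp
  ring

/-- **THE LEAF × TWO-LEAF STAR IDENTITY**: `θ_△(v c, v a * v b) = leafStar2A a b c + leafStar2B a b c`. -/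
theorem thetaTri_leaf_star2_eq (a b c : ℝ) :
    thetaTri (v c) (v a * v b) = leafStar2A a b c + leafStar2B a b c := by
  ext i
  fin_cases i
  · exact thetaTri_leaf_star2_coord0 a b c
  · exact thetaTri_leaf_star2_coord1 a b c
  · exact thetaTri_leaf_star2_coord2 a b c
  · exact thetaTri_leaf_star2_coord3 a b c
  · exact thetaTri_leaf_star2_coord4 a b c
  · exact thetaTri_leaf_star2_coord5 a b c

/-- **THEOREM (LEAF × TWO-LEAF STAR)**: `θ_△(v c, v a * v b) ∈ cone` for all `a, b, c ∈ [0, 1]`. -/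
theorem InCone_thetaTri_leaf_star2 (a b c : ℝ) (ha : 0 ≤ a ∧ a ≤ 1) (hb : 0 ≤ b ∧ b ≤ 1) (hc : 0 ≤ c ∧ c ≤ 1) :
    InCone (thetaTri (v c) (v a * v b)) := by
  rw [thetaTri_leaf_star2_eq]
  exact (InCone_leafStar2A a b c ha hb hc).add (InCone_leafStar2B a b c ha hb hc)

/-- The same for the pure root `V ![a, b]`. -/
theorem InCone_thetaTri_leaf_V2 (a b c : ℝ) (ha : 0 ≤ a ∧ a ≤ 1) (hb : 0 ≤ b ∧ b ≤ 1) (hc : 0 ≤ c ∧ c ≤ 1) :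
    InCone (thetaTri (v c) (V ![a, b])) := by
  have e : V ![a, b] = v a * v b := by
    unfold V
    rw [Fin.prod_univ_two]
    rfl
  rw [e]
  exact InCone_thetaTri_leaf_star2 a b c ha hb hc

/-- The mirror: a two-leaf star at the first exit, a leaf at the second. -/
theorem InCone_thetaTri_star2_leaf (a b c : ℝ) (ha : 0 ≤ a ∧ a ≤ 1) (hb : 0 ≤ b ∧ b ≤ 1) (hc : 0 ≤ c ∧ c ≤ 1) :
    InCone (thetaTri (v a * v b) (v c)) := by
  rw [thetaTri_comm]
  exact InCone_thetaTri_leaf_star2 a b c ha hb hc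

end RelaxedTriangle

end PercRepro
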